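import Summits.CriticalPhenomena.PercolationContinuityZ3.Theorems.SahiMasterFamilyCommonPivotalRestrict
import Summits.CriticalPhenomena.PercolationContinuityZ3.Theorems.SahiMasterFamilyTrichotomy

/-!
# Face-vanishing triples with a common pivotal coordinate are TIGHT (`FaceVanishingCommonPivotalTight` holds)

Unit `prim-masterthm-p4` (gen 12; crux anchor stmt-CriticalPhenomena-4575, helper work; memo
`run/shared/lean/prim/prim-masterthm/prim-masterthm-p4/P4-GEN12-REPORT.md`).  Completes gen 11's combinatorial target
`PositiveSomewhere.FaceVanishingCommonPivotalTight`: a triple of increasing events determined by `S`, all of whose minors at coordinates of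
`S` are zero flags, with a coordinate pivotal for all three members, has PRINCIPAL common part (`{T | ↑S ⊆ T}`).

* no member contains the other two: `principalCap_of_commonPivotal_noAbsorber` (glued frames at order three, `…CommonPivotalRestrict`);
* an ABSORBING member `U_l ⊇ U_m`: then the faces of the PAIR of the other two members are independent pairs
  (`disjoint_esupp_of_suppZeroFlag_three_absorber`), the pair is dependent (common pivotal coordinate), and the **face-vanishing pair lemma**
  (`not_coreFree_of_fvPair`: a dependent pair of non-sure increasing events all of whose deletion / contraction faces are independent has
  every coordinate in the core of one of its two members — proof: the two members read the same coordinates; at a core-free `f` the mixed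
  pair `(A^{f←0}, B^{f←1})` is again face-vanishing off `f` and dependent, so it reads equal coordinate sets, which forces `A^{f←0}` and
  `A^{f←1}` to have disjoint supports, hence `{f} ∈ B` (the `f`-contraction of `B` is everything); then the deletions at `f` read the same non-empty disjoint sets — absurd) gives the principal cap (`principalCap_of_commonPivotal_absorber`).
**`faceVanishingCommonPivotalTight_holds : FaceVanishingCommonPivotalTight`.**  Axioms standard. [this work]
-/

noncomputable section

open scoped Classical

namespace Summit.CriticalPhenomena.PercolationContinuityZ3.Theorems

namespace PositiveSomewhere

open Finset Function GluedFrames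
open Literature.Probability.Percolation (DeterminedBy determinedBy_iff)
open Literature.Probability.LatticeModels.Kahn2022 (Affects)

section PairLemma

variable {ι : Type*} [Fintype ι]

/-! ### Small support lemmas -/

/-- An increasing event containing a non-empty increasing event with disjoint support is everything. [this work] -/
theorem eq_univ_of_subset_of_disjoint_esupp {X Y : Set (Set ι)} (hX : IsUpperSet X) (hY : IsUpperSet Y) (hne : X.Nonempty)
    (hXY : X ⊆ Y) (hd : Disjoint (esupp X) (esupp Y)) : Y = Set.univ := by
  have h1 : (↑(esupp X) : Set ι) ∈ X :=
    (mem_iff_of_inter_esupp_eq hX (ω := Set.univ) (ω' := ↑(esupp X))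
      (by rw [Set.univ_inter, Set.inter_self])).1 (univ_mem_of_nonempty hX hne)
  have h2 : (∅ : Set ι) ∈ Y := by
    refine (mem_iff_of_inter_esupp_eq hY (ω := ↑(esupp X)) (ω' := ∅) ?_).1 (hXY h1)
    rw [Set.empty_inter]
    ext y; constructor
    · rintro ⟨hy1, hy2⟩; exact absurd (mem_coe.1 hy2) (Finset.disjoint_left.1 hd (mem_coe.1 hy1))
    · intro h; exact absurd h (Set.notMem_empty y)
  exact Set.eq_univ_of_forall fun ω => hY (Set.empty_subset ω) h2

/-! ### The face-vanishing pair lemma -/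

/-- **Pairs with independent faces reading different coordinate sets are independent**: if both `g`-faces of `(A, B)` are independent
pairs and `g` does not act on `A`, then `A ⟂ B`. [this work] -/
theorem disjoint_esupp_of_faces_of_not_mem {A B : Set (Set ι)} (hA : IsUpperSet A) {g : ι}
    (hface : ∀ b : Bool, Disjoint (esupp (secAt g b A)) (esupp (secAt g b B))) (hgA : g ∉ esupp A) :
    Disjoint (esupp A) (esupp B) := by
  have hAg : ∀ b, secAt g b A = A := fun b => secAt_eq_self_of_not_affects hA (fun h => hgA (mem_esupp.2 h)) b
  rw [Finset.disjoint_left]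
  intro y hyA hyB
  have hyg : y ≠ g := fun h => hgA (h ▸ hyA)
  rcases mem_esupp_secAt_or hyB hyg with h | h
  · exact Finset.disjoint_left.1 (hface false) (by rw [hAg]; exact hyA) h
  · exact Finset.disjoint_left.1 (hface true) (by rw [hAg]; exact hyA) h

/-- A face-vanishing DEPENDENT pair reads EVERY coordinate (in particular the two members read the same coordinates). [this work] -/
theorem mem_esupp_of_fvPair {A B : Set (Set ι)} (hA : IsUpperSet A)
    (hfv : ∀ (g : ι) (b : Bool), Disjoint (esupp (secAt g b A)) (esupp (secAt g b B))) (hdep : ¬ Disjoint (esupp A) (esupp B))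
    (g : ι) : g ∈ esupp A := by
  by_contra hgA
  exact hdep (disjoint_esupp_of_faces_of_not_mem hA (hfv g) hgA)

/-- The mixed step of the pair lemma: at a core-free `f` of a face-vanishing dependent pair, the `f`-deletion of `A` and the
`f`-contraction of `B` read the same coordinates. [this work] -/
theorem esupp_secAt_false_eq_of_fvPair {A B : Set (Set ι)} (hA : IsUpperSet A) (hB : IsUpperSet B) (hA0 : (∅ : Set ι) ∉ A)
    (hfv : ∀ (g : ι) (b : Bool), Disjoint (esupp (secAt g b A)) (esupp (secAt g b B)))
    (hdep : ¬ Disjoint (esupp A) (esupp B)) {f : ι} (hfA : Set.univ \ {f} ∈ A) :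
    esupp (secAt f false A) = esupp (secAt f true B) := by
  have hA0u : IsUpperSet (secAt f false A) := isUpperSet_secAt f false hA
  have hB1u : IsUpperSet (secAt f true B) := isUpperSet_secAt f true hB
  have hnotf : ∀ (X : Set (Set ι)) (b : Bool), f ∉ esupp (secAt f b X) :=
    fun X b h => not_affects_secAt f b X (mem_esupp.1 h)
  -- `S(A₀) ⊆ S(B₁)`: a coordinate of `A₀` is a coordinate of `A = B`, not of `B₀` (face at `f`), hence of `B₁`
  have hsub : ∀ g, g ∈ esupp (secAt f false A) → g ∈ esupp (secAt f true B) := by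
    intro g hg
    have hgf : g ≠ f := fun h => hnotf A false (h ▸ hg)
    have hgB : g ∈ esupp B :=
      mem_esupp_of_fvPair hB (fun g b => (hfv g b).symm) (fun h => hdep h.symm) g
    rcases mem_esupp_secAt_or hgB hgf with h | h
    · exact absurd h (Finset.disjoint_left.1 (hfv f false) hg)
    · exact h
  -- `A₀` is non-empty and non-sure: its support is non-empty
  have hne : (secAt f false A).Nonempty := ⟨Set.univ, by rw [mem_secAt]; simpa only [forceAt, cond_false] using hfA⟩
  have h0 : (∅ : Set ι) ∉ secAt f false A := by
    intro h; rw [mem_secAt] at h; simp only [forceAt, cond_false, Set.empty_sdiff] at h; exact hA0 h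
  obtain ⟨y, hy⟩ : (esupp (secAt f false A)).Nonempty := by
    by_contra h
    rw [not_nonempty_iff_eq_empty] at h
    rcases eq_empty_or_univ_of_esupp_eq_empty hA0u h with h' | h'
    · exact hne.ne_empty h'
    · exact h0 (h' ▸ Set.mem_univ _)
  -- `S(B₁) ⊆ S(A₀)`: otherwise a coordinate `g ≠ f` of `B₁` not read by `A₀` makes the mixed pair independent (its faces at `g` are
  -- sections of the independent `g`-faces of `(A, B)`), contradicting `∅ ≠ S(A₀) ⊆ S(B₁)`
  refine Subset.antisymm (fun g hg => hsub g hg) fun g hg => ?_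
  by_contra hgA0
  have hgf : g ≠ f := fun h => hnotf B true (h ▸ hg)
  have hfaces : ∀ b : Bool, Disjoint (esupp (secAt g b (secAt f false A))) (esupp (secAt g b (secAt f true B))) := by
    intro b
    rw [secAt_comm hgf, secAt_comm hgf]
    exact Finset.disjoint_of_subset_left ((esupp_secAt_subset (isUpperSet_secAt g b hA) f false).trans (erase_subset _ _))
      (Finset.disjoint_of_subset_right ((esupp_secAt_subset (isUpperSet_secAt g b hB) f true).trans (erase_subset _ _)) (hfv g b))
  have hdis := disjoint_esupp_of_faces_of_not_mem hA0u hfaces hgA0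
  exact Finset.disjoint_left.1 hdis hy (hsub y hy)

/-- **The face-vanishing pair lemma.**  Let `A, B` be increasing, non-sure, DEPENDENT events all of whose deletion and contraction
faces are independent pairs.  Then no coordinate is core-free: for every `f`, `univ ∖ {f} ∉ A` or `univ ∖ {f} ∉ B`. [this work] -/
theorem not_coreFree_of_fvPair {A B : Set (Set ι)} (hA : IsUpperSet A) (hB : IsUpperSet B)
    (hA0 : (∅ : Set ι) ∉ A) (hB0 : (∅ : Set ι) ∉ B)
    (hfv : ∀ (g : ι) (b : Bool), Disjoint (esupp (secAt g b A)) (esupp (secAt g b B)))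
    (hdep : ¬ Disjoint (esupp A) (esupp B)) (f : ι) :
    Set.univ \ {f} ∉ A ∨ Set.univ \ {f} ∉ B := by
  by_contra hcf
  push Not at hcf
  obtain ⟨hfA, hfB⟩ := hcf
  have hfv' : ∀ (g : ι) (b : Bool), Disjoint (esupp (secAt g b B)) (esupp (secAt g b A)) := fun g b => (hfv g b).symm
  have hdep' : ¬ Disjoint (esupp B) (esupp A) := fun h => hdep h.symm
  have hBA := esupp_secAt_false_eq_of_fvPair hB hA hB0 hfv' hdep' hfB    -- S(B₀) = S(A₁)
  have hd0 : Disjoint (esupp (secAt f false A)) (esupp (secAt f false B)) := hfv f false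
  have hd1 : Disjoint (esupp (secAt f true A)) (esupp (secAt f true B)) := hfv f true
  -- `B₀ ⊆ B₁` have disjoint supports (`S(B₀) = S(A₁)`, face at `f`), so `B₁ = univ`, i.e. `{f} ∈ B`
  have hdB : Disjoint (esupp (secAt f false B)) (esupp (secAt f true B)) := by
    rw [Finset.disjoint_left]; intro y hy0 hy1
    exact Finset.disjoint_left.1 hd1 (by rw [← hBA]; exact hy0) hy1
  have hneA : (secAt f false A).Nonempty := ⟨Set.univ, by rw [mem_secAt]; simpa only [forceAt, cond_false] using hfA⟩
  have hneB : (secAt f false B).Nonempty := ⟨Set.univ, by rw [mem_secAt]; simpa only [forceAt, cond_false] using hfB⟩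
  have hsatB : secAt f true B = Set.univ :=
    eq_univ_of_subset_of_disjoint_esupp (isUpperSet_secAt f false hB) (isUpperSet_secAt f true hB) hneB
      (secAt_false_subset_true hB f) hdB
  -- now `A₀` and `B₀` read `S(A) ∖ f = S(B) ∖ f ≠ ∅` — but they are independent
  have h0 : (∅ : Set ι) ∉ secAt f false A := by
    intro h; rw [mem_secAt] at h; simp only [forceAt, cond_false, Set.empty_sdiff] at h; exact hA0 h
  obtain ⟨y, hy⟩ : (esupp (secAt f false A)).Nonempty := by
    by_contra h
    rw [not_nonempty_iff_eq_empty] at h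
    rcases eq_empty_or_univ_of_esupp_eq_empty (isUpperSet_secAt f false hA) h with h' | h'
    · exact hneA.ne_empty h'
    · exact h0 (h' ▸ Set.mem_univ _)
  have hyf : y ≠ f := fun h => not_affects_secAt f false A (mem_esupp.1 (h ▸ hy))
  have hyB : y ∈ esupp B := mem_esupp_of_fvPair hB hfv' hdep' y
  exact Finset.disjoint_left.1 hd0 hy (erase_subset_esupp_secAt_false hsatB (mem_erase.2 ⟨hyf, hyB⟩))

/-! ### An absorbing member: the other two form a face-vanishing pair -/

/-- In `Z_3` with an absorbing last member `G ⊇ X, Y`, the pair `(X, Y)` is independent. [this work] -/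
theorem disjoint_esupp_of_suppZeroFlag_three_absorber {X Y G : Set (Set ι)} (hX : IsUpperSet X) (hY : IsUpperSet Y)
    (hXG : X ⊆ G) (hYG : Y ⊆ G) (h : SuppZeroFlag 3 ![X, Y, G]) : Disjoint (esupp X) (esupp Y) := by
  rcases (suppZeroFlag_three_iff_zVia X Y G).1 h with h | h | h
  · obtain ⟨-, -, h3⟩ := h
    rw [Set.inter_eq_right.2 hXG] at h3
    exact ((suppZeroFlag_two_iff hY hX).1 h3).symm
  · obtain ⟨-, -, h3⟩ := h
    rw [Set.inter_eq_right.2 hYG] at h3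
    exact (suppZeroFlag_two_iff hX hY).1 h3
  · obtain ⟨h1, -, -⟩ := h
    exact (suppZeroFlag_two_iff hX hY).1 h1

/-- The same for a `Fin 3`-family with absorbing member `l`: the two other members are independent. [this work] -/
theorem disjoint_esupp_succAbove_of_absorber (V : Fin 3 → Set (Set ι)) (hV : ∀ j, IsUpperSet (V j)) (l : Fin 3)
    (habs : ∀ m, m ≠ l → V m ⊆ V l) (h : SuppZeroFlag 3 V) :
    Disjoint (esupp (V (l.succAbove 0))) (esupp (V (l.succAbove 1))) := by
  have hVec : V = ![V 0, V 1, V 2] := by funext j; fin_cases j <;> rfl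
  rw [hVec] at h
  fin_cases l
  · -- absorber `V 0`; others `V 1, V 2`
    have h' : SuppZeroFlag 3 ![V 1, V 2, V 0] := by
      rw [suppZeroFlag_three_swap23 (hV 1) (hV 2) (hV 0), suppZeroFlag_three_swap12 (hV 1) (hV 0) (hV 2)]; exact h
    exact disjoint_esupp_of_suppZeroFlag_three_absorber (hV 1) (hV 2) (habs 1 (by decide)) (habs 2 (by decide)) h'
  · -- absorber `V 1`; others `V 0, V 2`
    have h' : SuppZeroFlag 3 ![V 0, V 2, V 1] := by
      rw [suppZeroFlag_three_swap23 (hV 0) (hV 2) (hV 1)]; exact h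
    exact disjoint_esupp_of_suppZeroFlag_three_absorber (hV 0) (hV 2) (habs 0 (by decide)) (habs 2 (by decide)) h'
  · exact disjoint_esupp_of_suppZeroFlag_three_absorber (hV 0) (hV 1) (habs 0 (by decide)) (habs 1 (by decide)) h

end PairLemma

/-! ### Tightness -/

/-- **Principal cap for common-pivotal face-vanishing triples WITH an absorbing member.** [this work] -/
theorem principalCap_of_commonPivotal_absorber (ι : Type) [Fintype ι] (U : Fin 3 → Set (Set ι)) (S : Finset ι)
    (hU : ∀ j, IsUpperSet (U j)) (hUS : ∀ j, DeterminedBy (U j) (↑S : Set ι))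
    (hpiv : ∃ e : ι, ∀ j, ∃ ω, e ∉ ω ∧ ω ∉ U j ∧ insert e ω ∈ U j)
    (hfv : ∀ e ∈ S, ∀ b : Bool, SuppZeroFlag 3 (fun j => secAt e b (U j)))
    (l : Fin 3) (habs : ∀ m, m ≠ l → U m ⊆ U l) :
    ∀ T : Set ι, (∀ j, T ∈ U j) ↔ (↑S : Set ι) ⊆ T := by
  obtain ⟨e, he⟩ := hpiv
  have hne : ∀ j, (U j).Nonempty := fun j => by obtain ⟨ω, -, -, h⟩ := he j; exact ⟨_, h⟩
  have h0 : ∀ j, (∅ : Set ι) ∉ U j := fun j => empty_notMem_of_pivotal (U j) (hU j) (he j)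
  have heS : e ∈ S := by
    obtain ⟨ω, -, hω, hωe⟩ := he 0
    exact esupp_subset_of_determinedBy (hUS 0) (mem_esupp.2 ⟨ω, hω, hωe⟩)
  set a := l.succAbove 0 with hadef
  set b := l.succAbove 1 with hbdef
  set A : Set (Set ↥S) := pull S (U a) with hAdef
  set B : Set (Set ↥S) := pull S (U b) with hBdef
  have hAu : IsUpperSet A := isUpperSet_pull S (hU a)
  have hBu : IsUpperSet B := isUpperSet_pull S (hU b)
  -- the pair `(A, B)` is face-vanishing on `↥S`
  have hfvAB : ∀ (g : ↥S) (bb : Bool), Disjoint (esupp (secAt g bb A)) (esupp (secAt g bb B)) := by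
    intro g bb
    have hZ : SuppZeroFlag 3 (fun j => secAt g bb (pull S (U j))) := by
      have := suppZeroFlag_pull S 3 _ (hfv g g.2 bb)
      convert this using 1
      funext j
      exact (pull_secAt S (U j) g bb).symm
    have := disjoint_esupp_succAbove_of_absorber (fun j => secAt g bb (pull S (U j)))
      (fun j => isUpperSet_secAt g bb (isUpperSet_pull S (hU j))) l
      (fun m hm => fun ω hω => by
        rw [mem_secAt, mem_pull] at hω ⊢
        exact habs m hm hω) hZ
    exact this
  -- and dependent (the common pivotal coordinate)
  have hdep : ¬ Disjoint (esupp A) (esupp B) := by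
    intro hd
    have hmem : ∀ j, (⟨e, heS⟩ : ↥S) ∈ esupp (pull S (U j)) := fun j =>
      mem_esupp.2 ((affects_pull_iff S (hUS j) ⟨e, heS⟩).2 (by obtain ⟨ω, -, hω, hωe⟩ := he j; exact ⟨ω, hω, hωe⟩))
    exact Finset.disjoint_left.1 hd (hmem a) (hmem b)
  have hcf := not_coreFree_of_fvPair hAu hBu (empty_not_mem_pull S (h0 a)) (empty_not_mem_pull S (h0 b)) hfvAB hdep
  -- so the common part of `(A, B)` on `↥S` is `{univ}`
  have hcap : ∀ T' : Set ↥S, T' ∈ A → T' ∈ B → T' = Set.univ := by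
    intro T' hTA hTB
    by_contra hT'
    obtain ⟨f, hf⟩ : ∃ f, f ∉ T' := by
      by_contra h; push Not at h; exact hT' (Set.eq_univ_of_forall h)
    have hsub : T' ⊆ Set.univ \ {f} := fun z hz => ⟨Set.mem_univ z, fun h => hf (by rw [Set.mem_singleton_iff] at h; exact h ▸ hz)⟩
    rcases hcf f with h | h
    · exact h (hAu hsub hTA)
    · exact h (hBu hsub hTB)
  -- transfer back to `ι`
  intro T
  constructor
  · intro hT
    have h' : ∀ j, (Subtype.val : ↥S → ι) ⁻¹' T ∈ pull S (U j) := fun j => (mem_iff_preimage_mem_pull S (hUS j) T).1 (hT j)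
    have huniv := hcap _ (h' a) (h' b)
    intro y hy
    have : (⟨y, hy⟩ : ↥S) ∈ (Subtype.val : ↥S → ι) ⁻¹' T := by rw [huniv]; exact Set.mem_univ _
    exact this
  · intro h j
    have huniv : Set.univ ∈ U j := univ_mem_of_nonempty (hU j) (hne j)
    refine ((determinedBy_iff (U j) ↑S).1 (hUS j) T Set.univ ?_).2 huniv
    rw [Set.univ_inter, Set.inter_eq_right.2 h]

/-- **`FaceVanishingCommonPivotalTight` holds**: a triple of increasing events determined by `S`, all of whose minors at coordinates
of `S` are zero flags, with a coordinate pivotal for all three, has principal common part `{T | ↑S ⊆ T}`. [this work] -/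
theorem faceVanishingCommonPivotalTight_holds : FaceVanishingCommonPivotalTight := by
  intro ι _ U S hU hUS hpiv hfv
  by_cases habs : ∃ l, ∀ m, m ≠ l → U m ⊆ U l
  · obtain ⟨l, hl⟩ := habs
    exact ⟨S, principalCap_of_commonPivotal_absorber ι U S hU hUS hpiv hfv l hl⟩
  · push Not at habs
    exact ⟨S, principalCap_of_commonPivotal_noAbsorber ι U S hU hUS hpiv hfv habs⟩

end PositiveSomewhere

end Summit.CriticalPhenomena.PercolationContinuityZ3.Theorems
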